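import Mathlib
import Summits.Ventures.HodgeRepro2.T5GaussianField
import Summits.Ventures.HodgeRepro2.T5GaussianPlace
import Summits.Ventures.HodgeRepro2.T5CompletionDegreeSum
import Summits.Ventures.HodgeRepro2.T6N5LocalSignModelGlobal
import Summits.Ventures.HodgeRepro2.T6N5LocalSignModelCM

/-!
# T6N5LocalSignModelCMNonSplit — Tier 6, M2 sub-step N5 (t6-p8's half): THE `ns` AND `re` CLAUSES OF THE CM FORM
ARE NOT VACUOUS — the place of `E⁺` under a finite place of `E` that is the only place containing a rational
integer is non-split, for EVERY subfield `E⁺` (no transport of place data across `E⁺ ≅ ℚ`)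

`T6N5LocalSignModelCM` states the host-shaped sign-model theorem on a CM field `E` over `E⁺ = maximalRealSubfield E`
and its witness file instantiates it at `ℚ(ζ₄)`; what was left open there (README §10.5(ii)(c)) is that the kind
`ns` actually OCCURS in `kindOf E⁺ E` for `E = ℚ(ζ₄)` — the `ofGlobal` form had `kindOf_v₂` on the base `ℚ`, and
`E⁺ = maximalRealSubfield ℚ(ζ₄)` is a subfield isomorphic to `ℚ`, not `ℚ` itself. This file closes that item
WITHOUT identifying `E⁺` with `ℚ`:
* `placeUnder K w` — the place of `K` under a finite place `w` of `L` (the prime `w ∩ 𝓞_K`, Mathlib's `Ideal.under`;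
  non-zero because `𝓞_L` is integral over `𝓞_K`), with `w` lying over it (`liesOver_placeUnder`, an instance) and
  `natCast_mem_placeUnder_iff` (a rational integer lies in `placeUnder K w` iff it lies in `w`);
* `isNonSplit_placeUnder` — if `w` contains the rational integer `n` and is the ONLY place of `L` containing `n`,
  then `placeUnder K w` is non-split in `L` (`IsNonSplit K L`), for every field `K` with `L` a `K`-algebra:
  a place `w'` over `placeUnder K w` contains `n`, hence is `w` — the whole argument runs through the element `n`,
  so the base `K` is never identified with anything;
* on `ℚ(ζ₄)`: `liesOver_v₂_of_two_mem` (a place containing `2` lies over `v₂`, by maximality of `v₂ = (2)`),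
  `eq_of_two_mem` (the place above `2` is the only place containing `2` — p4's quadratic dictionary
  `T5CompletionDegreeSum.unique_of_finrank_eq_two` with `[L_w : ℚ₂] = 2`), `w₂` (the place above `2`, with
  `two_mem_w₂`), `isNonSplit_placeUnder_w₂` (the place under `w₂` is non-split for EVERY base `K ⊆ ℚ(ζ₄)`),
  `kindOf_placeUnder_w₂`;
* `exists_kindOf_eq_ns_cm` — THE OPEN ITEM: `kindOf (maximalRealSubfield ℚ(ζ₄)) ℚ(ζ₄)` takes the value `ns` (at
  the place of `E⁺` under `w₂`), so the `ns` clause of `gaussian_cm_witness` is not vacuous; `exists_kindOf_eq_ns_rat`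
  — the same on the base `ℚ` (a second proof of the gen-7 `kindOf_v₂`, through `placeUnder`);
* `exists_kindOf_eq_re_cm` — for EVERY CM field `E`, `kindOf E⁺ E` takes the value `re` (every infinite place of
  `E⁺` is real and `E⁺` has an infinite place), so the real clause of `cm_global_witness E` is never vacuous.
Definition lane (2 defs `placeUnder` / `w₂` + 2 instances `liesOver_placeUnder` / `w₂_liesOver`; count prose corrected per t6-ref-1 n-g30-1, STATUS l. 12995); no display; nothing automorphic. Filed in WAVE 1 (p438085, 2026-08-26); v2 p448386; this v3 docstring-only.
§8(d): uses an L-value-free non-vanishing device: NO.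
-/

namespace Summit.Ventures.HodgeRepro2.T6.N5LocalSignModelCMNonSplit

open Summit.Ventures.HodgeRepro2 IsDedekindDomain HeightOneSpectrum NumberField
  Summit.Ventures.HodgeRepro2.T6.N5Rich Summit.Ventures.HodgeRepro2.T6.N5LocalSignModelGlobal
  Summit.Ventures.HodgeRepro2.T6.N5LocalSignModelCM

noncomputable section

/-! ### The place under a finite place, and non-splitness from a rational integer -/

section Under

variable (K : Type) [Field K] [NumberField K] {L : Type} [Field L] [NumberField L] [Algebra K L]

/-- THE PLACE OF `K` UNDER a finite place `w` of `L`: the prime `w ∩ 𝓞_K` (Mathlib's `Ideal.under`), a non-zero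
prime of `𝓞_K` because `𝓞_L` is integral over `𝓞_K` (Mathlib's `Ideal.under_ne_bot`). -/
def placeUnder (w : HeightOneSpectrum (RingOfIntegers L)) : HeightOneSpectrum (RingOfIntegers K) where
  asIdeal := w.asIdeal.under (RingOfIntegers K)
  isPrime := Ideal.IsPrime.under (RingOfIntegers K) w.asIdeal
  ne_bot := Ideal.under_ne_bot (RingOfIntegers K) w.ne_bot

/-- `w` lies over the place under it. -/
instance liesOver_placeUnder (w : HeightOneSpectrum (RingOfIntegers L)) :
    w.asIdeal.LiesOver (placeUnder K w).asIdeal :=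
  ⟨rfl⟩

omit [NumberField K] [NumberField L] in
/-- Membership in the place under `w`: `x ∈ w ∩ 𝓞_K` iff the image of `x` lies in `w`. -/
theorem mem_placeUnder_iff (w : HeightOneSpectrum (RingOfIntegers L)) (x : RingOfIntegers K) :
    x ∈ (placeUnder K w).asIdeal ↔ algebraMap (RingOfIntegers K) (RingOfIntegers L) x ∈ w.asIdeal :=
  Iff.rfl

omit [NumberField K] [NumberField L] in
/-- A rational integer lies in the place under `w` iff it lies in `w`. -/
theorem natCast_mem_placeUnder_iff (w : HeightOneSpectrum (RingOfIntegers L)) (n : ℕ) :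
    (n : RingOfIntegers K) ∈ (placeUnder K w).asIdeal ↔ (n : RingOfIntegers L) ∈ w.asIdeal := by
  rw [mem_placeUnder_iff, map_natCast]

omit [NumberField K] [NumberField L] in
/-- NON-SPLITNESS FROM A RATIONAL INTEGER, for every base: if the finite place `w` of `L` contains the rational
integer `n` and is the ONLY place of `L` containing `n`, then the place of `K` under `w` is non-split in `L`
(`IsNonSplit K L`): `w` lies over it, and a place `w'` over it contains `n` (its trace on `𝓞_K` is that of `w`,
which contains `n`), hence is `w`. The base `K` is never identified with anything. -/
theorem isNonSplit_placeUnder (w : HeightOneSpectrum (RingOfIntegers L)) (n : ℕ)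
    (hn : (n : RingOfIntegers L) ∈ w.asIdeal)
    (huniq : ∀ w' : HeightOneSpectrum (RingOfIntegers L), (n : RingOfIntegers L) ∈ w'.asIdeal → w' = w) :
    IsNonSplit K L (placeUnder K w) := by
  refine ⟨w, liesOver_placeUnder K w, fun w' hw' => huniq w' ?_⟩
  have h1 : (n : RingOfIntegers K) ∈ (placeUnder K w).asIdeal := (natCast_mem_placeUnder_iff K w n).2 hn
  rw [hw'.over] at h1
  exact (natCast_mem_placeUnder_iff K w' n).1 h1

omit [NumberField K] [NumberField L] in
/-- … and its kind in `kindOf K L` is `ns`. -/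
theorem kindOf_placeUnder_eq_ns (w : HeightOneSpectrum (RingOfIntegers L)) (n : ℕ)
    (hn : (n : RingOfIntegers L) ∈ w.asIdeal)
    (huniq : ∀ w' : HeightOneSpectrum (RingOfIntegers L), (n : RingOfIntegers L) ∈ w'.asIdeal → w' = w) :
    kindOf K L (Sum.inl (placeUnder K w)) = PlaceKind.ns :=
  kindOf_eq_ns (isNonSplit_placeUnder K w n hn huniq)

end Under

/-! ### `ℚ(ζ₄)`: the place above `2` is the only place containing `2` -/

section Gaussian

open Summit.Ventures.HodgeRepro2.T5GaussianField

/-- A finite place of `ℚ(ζ₄)` containing `2` lies over `v₂`: its trace on `𝓞_ℚ` is a proper ideal containing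
`v₂ = (2)` (p4's `T5GaussianPlace.asIdeal_v₂`), hence equals `v₂` by maximality. -/
theorem liesOver_v₂_of_two_mem (w' : HeightOneSpectrum (RingOfIntegers L))
    (h2 : (2 : RingOfIntegers L) ∈ w'.asIdeal) : w'.asIdeal.LiesOver v₂.asIdeal := by
  constructor
  refine v₂.isMaximal.eq_of_le (Ideal.IsPrime.ne_top (Ideal.IsPrime.under (RingOfIntegers ℚ) w'.asIdeal)) ?_
  rw [T5GaussianPlace.asIdeal_v₂, Ideal.span_le, Set.singleton_subset_iff]
  change algebraMap (RingOfIntegers ℚ) (RingOfIntegers L) 2 ∈ w'.asIdeal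
  rw [map_ofNat]
  exact h2

/-- THE PLACE ABOVE `2` IS THE ONLY PLACE OF `ℚ(ζ₄)` CONTAINING `2`: a place containing `2` lies over `v₂`, and
`w` is the only place over `v₂` because `[L_w : ℚ₂] = 2` (p4's `T5GaussianPlace.finrank_eq_two` and the quadratic
dictionary `T5CompletionDegreeSum.unique_of_finrank_eq_two`). -/
theorem eq_of_two_mem (w : HeightOneSpectrum (RingOfIntegers L)) [w.asIdeal.LiesOver v₂.asIdeal]
    (w' : HeightOneSpectrum (RingOfIntegers L)) (h2 : (2 : RingOfIntegers L) ∈ w'.asIdeal) : w' = w :=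
  T5CompletionDegreeSum.unique_of_finrank_eq_two v₂ finrank_eq_two w (T5GaussianPlace.finrank_eq_two w) w'
    (liesOver_v₂_of_two_mem w' h2)

/-- THE PLACE OF `ℚ(ζ₄)` ABOVE `2` (p4's `T5GaussianPlace.exists_liesOver`). -/
def w₂ : HeightOneSpectrum (RingOfIntegers L) :=
  T5GaussianPlace.exists_liesOver.choose

/-- `w₂` lies over `v₂`. -/
instance w₂_liesOver : w₂.asIdeal.LiesOver v₂.asIdeal :=
  T5GaussianPlace.exists_liesOver.choose_spec

/-- `2 ∈ w₂`. -/
theorem two_mem_w₂ : (2 : RingOfIntegers L) ∈ w₂.asIdeal :=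
  T5GaussianPlace.two_mem_w w₂

/-- `(2 : ℕ) ∈ w₂` (the cast form read by `isNonSplit_placeUnder`). -/
theorem natCast_two_mem_w₂ : ((2 : ℕ) : RingOfIntegers L) ∈ w₂.asIdeal := by
  rw [Nat.cast_ofNat]
  exact two_mem_w₂

/-- THE PLACE UNDER `w₂` IS NON-SPLIT FOR EVERY BASE `K ⊆ ℚ(ζ₄)` — in particular for
`K = maximalRealSubfield ℚ(ζ₄)`, without identifying it with `ℚ`. -/
theorem isNonSplit_placeUnder_w₂ (K : Type) [Field K] [Algebra K L] :
    IsNonSplit K L (placeUnder K w₂) :=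
  isNonSplit_placeUnder K w₂ 2 natCast_two_mem_w₂ fun w' h => eq_of_two_mem w₂ w' (by rwa [Nat.cast_ofNat] at h)

/-- … of kind `ns`. -/
theorem kindOf_placeUnder_w₂ (K : Type) [Field K] [Algebra K L] :
    kindOf K L (Sum.inl (placeUnder K w₂)) = PlaceKind.ns :=
  kindOf_eq_ns (isNonSplit_placeUnder_w₂ K)

/-- THE OPEN ITEM OF THE CM FORM CLOSED: `kindOf (maximalRealSubfield ℚ(ζ₄)) ℚ(ζ₄)` takes the value `ns` — at the
place of `E⁺` under `w₂` — so the `ns` clause of `gaussian_cm_witness` (the `Solves` conjunct, quantified over the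
places of kind `ns`) is not vacuous (README §10.5(ii)(c)). -/
theorem exists_kindOf_eq_ns_cm :
    ∃ x : GlobalIndex (maximalRealSubfield L), kindOf (maximalRealSubfield L) L x = PlaceKind.ns :=
  ⟨Sum.inl (placeUnder (maximalRealSubfield L) w₂), kindOf_placeUnder_w₂ (maximalRealSubfield L)⟩

/-- The same on the base `ℚ` (a second proof of the gen-7 `kindOf_v₂`, through the place under `w₂`). -/
theorem exists_kindOf_eq_ns_rat : ∃ x : GlobalIndex ℚ, kindOf ℚ L x = PlaceKind.ns :=
  ⟨Sum.inl (placeUnder ℚ w₂), kindOf_placeUnder_w₂ ℚ⟩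

end Gaussian

/-! ### The real clause of the CM form is never vacuous -/

section CMReal

/-- For EVERY CM field `E`, `kindOf E⁺ E` takes the value `re`: `E⁺ = maximalRealSubfield E` is a number field,
so it has an infinite place, and every infinite place of `E⁺` is real (`isReal_infinitePlace_maximalRealSubfield`).
So the real clause of `cm_global_witness E` is not vacuous (README §10.5(ii)(c)). -/
theorem exists_kindOf_eq_re_cm (E : Type) [Field E] [NumberField E] :
    ∃ x : GlobalIndex (maximalRealSubfield E), kindOf (maximalRealSubfield E) E x = PlaceKind.re := by
  obtain ⟨τ⟩ : Nonempty (InfinitePlace (maximalRealSubfield E)) := inferInstance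
  exact ⟨Sum.inr ⟨τ, isReal_infinitePlace_maximalRealSubfield E τ⟩, kindOf_inr _⟩

end CMReal

end

end Summit.Ventures.HodgeRepro2.T6.N5LocalSignModelCMNonSplit
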